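import Summits.AtomisticToContinuum.Crystallization.Theorems.ReggeStarCoercivityDefectFreeCrystallizesPalmDefs
import Mathlib.Analysis.InnerProductSpace.PiL2
import Mathlib.Algebra.Order.Floor.Semiring

/-!
# Points of a separated set in the boundary layer of a cube window are `O(L²)` (stub B of line `palm-good-law`,
# crux stmt-AtomisticToContinuum-13603)

Stub `stub_funnelBoundaryCount` of the lead-c2 skeleton `Cruxes/DefectFreeCrystallizes/Lines/palm_good_law.lean`:
for every `δ > 0` there is `c > 0` such that for every `δ`-separated `S ⊆ ℝ³`, `L ≥ 1`, corner `a` and finite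
`B ⊆ S ∩ [a, a+L)³` all of whose points are within `6/5` of the boundary of the cube in some coordinate, `#B ≤ c·L²`.

Proof (elementary packing count, no measure theory).  `B` is covered by the six slabs
`{z | z i < a i + 6/5}` and `{z | a i + L - 6/5 ≤ z i}`, `i : Fin 3`, each of which is a half-open box with two
sides `L` and one side `6/5` (`card_le_six_mul`, union bound).  In a half-open box `∏ⱼ [lo j, lo j + len j)` the
cell map `z ↦ (⌊(z j - lo j)/(δ/2)⌋₊)ⱼ` is injective on points of `S` (two points of one cell of side `δ/2` are at
distance `< δ`) and lands in a grid with `∏ⱼ (⌊len j/(δ/2)⌋₊ + 1)` cells (`card_le_prod_of_separated_box`); with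
`L ≥ 1` the slab bound `(12/(5δ) + 1)·(2L/δ + 1)² ≤ (12/(5δ) + 1)·(2/δ + 1)²·L²` gives
`c := 6·(12/(5δ) + 1)·(2/δ + 1)²`.
-/

noncomputable section

namespace Summit.AtomisticToContinuum.Crystallization.Theorems.PalmGoodLaw.FunnelBoundaryCount

open Metric

/-- **Cell count in a half-open box.**  If `S ⊆ ℝ³` is `δ`-separated and the finite set `B ⊆ S` lies in the
half-open box `∏ⱼ [lo j, lo j + len j)`, then `#B ≤ ∏ⱼ (len j / (δ/2) + 1)`: the cell map
`z ↦ (⌊(z j - lo j)/(δ/2)⌋₊)ⱼ` is injective on `B` (two points in one cell of side `δ/2` are at distance `< δ`)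
and its image lies in a grid of `∏ⱼ (⌊len j/(δ/2)⌋₊ + 1)` cells. [folklore] -/
theorem card_le_prod_of_separated_box {δ : ℝ} (hδ : 0 < δ) {S : Set (EuclideanSpace ℝ (Fin 3))}
    (hS : ∀ x ∈ S, ∀ z ∈ S, x ≠ z → δ ≤ dist x z) (lo len : Fin 3 → ℝ) (hlen : ∀ j, 0 ≤ len j)
    (B : Finset (EuclideanSpace ℝ (Fin 3))) (hBS : ∀ z ∈ B, z ∈ S)
    (hbox : ∀ z ∈ B, ∀ j, lo j ≤ z j ∧ z j < lo j + len j) :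
    (B.card : ℝ) ≤ ∏ j, (len j / (δ / 2) + 1) := by
  have hpos : 0 < δ / 2 := by positivity
  have hne : δ / 2 ≠ 0 := hpos.ne'
  -- the cell map lands in the grid and is injective on `B`
  have key : B.card ≤
      (Fintype.piFinset fun j : Fin 3 => Finset.range (⌊len j / (δ / 2)⌋₊ + 1)).card := by
    refine Finset.card_le_card_of_injOn (fun z j => ⌊(z j - lo j) / (δ / 2)⌋₊) ?_ ?_
    · intro z hz
      rw [Finset.mem_coe] at hz
      rw [Finset.mem_coe, Fintype.mem_piFinset]
      intro j
      rw [Finset.mem_range]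
      refine Nat.lt_succ_of_le (Nat.floor_le_floor ?_)
      exact div_le_div_of_nonneg_right (by linarith [(hbox z hz j).2]) hpos.le
    · intro x hx z hz hxz
      rw [Finset.mem_coe] at hx hz
      by_contra hxne
      have hsep : δ ≤ dist x z := hS x (hBS x hx) z (hBS z hz) hxne
      -- coordinates of two points of one cell differ by `< δ/2`
      have hcoord : ∀ j, dist (x j) (z j) ^ 2 < (δ / 2) ^ 2 := by
        intro j
        have hj : ⌊(x j - lo j) / (δ / 2)⌋₊ = ⌊(z j - lo j) / (δ / 2)⌋₊ := congr_fun hxz j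
        have hx0 : 0 ≤ (x j - lo j) / (δ / 2) := div_nonneg (by linarith [(hbox x hx j).1]) hpos.le
        have hz0 : 0 ≤ (z j - lo j) / (δ / 2) := div_nonneg (by linarith [(hbox z hz j).1]) hpos.le
        have hcast : (⌊(x j - lo j) / (δ / 2)⌋₊ : ℝ) = ⌊(z j - lo j) / (δ / 2)⌋₊ := by rw [hj]
        have hxl := Nat.lt_floor_add_one ((x j - lo j) / (δ / 2))
        have hzl := Nat.lt_floor_add_one ((z j - lo j) / (δ / 2))
        have hxf := Nat.floor_le hx0
        have hzf := Nat.floor_le hz0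
        have h1 : (x j - lo j) / (δ / 2) - (z j - lo j) / (δ / 2) < 1 := by linarith
        have h2 : (z j - lo j) / (δ / 2) - (x j - lo j) / (δ / 2) < 1 := by linarith
        have hd : x j - z j = ((x j - lo j) / (δ / 2) - (z j - lo j) / (δ / 2)) * (δ / 2) := by
          rw [← sub_div, div_mul_cancel₀ _ hne]; ring
        have hsq : ((x j - lo j) / (δ / 2) - (z j - lo j) / (δ / 2)) ^ 2 < 1 := by
          nlinarith [mul_pos (show (0 : ℝ) < 1 - ((x j - lo j) / (δ / 2) - (z j - lo j) / (δ / 2)) by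
            linarith) (show (0 : ℝ) < 1 + ((x j - lo j) / (δ / 2) - (z j - lo j) / (δ / 2)) by
            linarith)]
        calc dist (x j) (z j) ^ 2
            = ((x j - lo j) / (δ / 2) - (z j - lo j) / (δ / 2)) ^ 2 * (δ / 2) ^ 2 := by
              rw [Real.dist_eq, sq_abs, hd]; ring
          _ < 1 * (δ / 2) ^ 2 := mul_lt_mul_of_pos_right hsq (by positivity)
          _ = (δ / 2) ^ 2 := one_mul _
      have hlt : dist x z < δ := by
        rw [EuclideanSpace.dist_eq, Real.sqrt_lt' hδ, Fin.sum_univ_three]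
        have h0 := hcoord 0
        have h1 := hcoord 1
        have h2 := hcoord 2
        have hδ2 : 0 < δ ^ 2 := by positivity
        linarith
      exact absurd hsep (not_le.mpr hlt)
  rw [Fintype.card_piFinset] at key
  simp only [Finset.card_range] at key
  calc (B.card : ℝ) ≤ ∏ j, ((⌊len j / (δ / 2)⌋₊ : ℝ) + 1) := by exact_mod_cast key
    _ ≤ ∏ j, (len j / (δ / 2) + 1) := by
        apply Finset.prod_le_prod
        · intro j _
          positivity
        · intro j _
          have := Nat.floor_le (div_nonneg (hlen j) hpos.le)
          linarith

/-- A product over `Fin 3` of a function that is constant off one index `i` equals its value at `i` times the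
square of that constant. -/
theorem prod_fin_three_eq_mul_sq (f : Fin 3 → ℝ) (i : Fin 3) (q : ℝ) (hf : ∀ j, j ≠ i → f j = q) :
    ∏ j, f j = f i * q ^ 2 := by
  rw [← Finset.mul_prod_erase Finset.univ f (Finset.mem_univ i)]
  congr 1
  have hcard : (Finset.univ.erase i).card = 2 := by
    rw [Finset.card_erase_of_mem (Finset.mem_univ i), Finset.card_univ, Fintype.card_fin]
  rw [Finset.prod_congr rfl fun j hj => hf j (Finset.ne_of_mem_erase hj), Finset.prod_const, hcard]

/-- **Union bound over six slabs.**  If every element of a finite set `B` satisfies `P i` or `Q i` for some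
`i : Fin 3`, and each of the six filtered subsets has at most `M` elements, then `#B ≤ 6M`. -/
theorem card_le_six_mul {α : Type*} [DecidableEq α] (B : Finset α) (P Q : Fin 3 → α → Prop)
    [∀ i, DecidablePred (P i)] [∀ i, DecidablePred (Q i)] (hB : ∀ z ∈ B, ∃ i, P i z ∨ Q i z) (M : ℝ)
    (hP : ∀ i, ((B.filter (P i)).card : ℝ) ≤ M) (hQ : ∀ i, ((B.filter (Q i)).card : ℝ) ≤ M) :
    (B.card : ℝ) ≤ 6 * M := by
  have hcover : B ⊆ Finset.univ.biUnion fun i => B.filter (P i) ∪ B.filter (Q i) := by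
    intro z hz
    obtain ⟨i, hi⟩ := hB z hz
    rw [Finset.mem_biUnion]
    refine ⟨i, Finset.mem_univ i, ?_⟩
    rw [Finset.mem_union]
    rcases hi with hi | hi
    · exact Or.inl (Finset.mem_filter.2 ⟨hz, hi⟩)
    · exact Or.inr (Finset.mem_filter.2 ⟨hz, hi⟩)
  have hcardN : B.card ≤ ∑ i, ((B.filter (P i)).card + (B.filter (Q i)).card) :=
    (Finset.card_le_card hcover).trans
      (Finset.card_biUnion_le.trans (Finset.sum_le_sum fun i _ => Finset.card_union_le _ _))
  calc (B.card : ℝ) ≤ ∑ i, (((B.filter (P i)).card : ℝ) + (B.filter (Q i)).card) := by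
        exact_mod_cast hcardN
    _ ≤ ∑ _i : Fin 3, (M + M) := Finset.sum_le_sum fun i _ => add_le_add (hP i) (hQ i)
    _ = 6 * M := by
        rw [Finset.sum_const, Finset.card_univ, Fintype.card_fin, nsmul_eq_mul]
        push_cast
        ring

/-- **Stub `stub_funnelBoundaryCount` (B) of line `palm-good-law`.**  `O(L²)` points of a `δ`-separated set lie in the
`6/5`-boundary layer of a half-open cube window of side `L ≥ 1`. [folklore] -/
theorem stub_funnelBoundaryCount :
    ∀ δ : ℝ, 0 < δ → ∃ c : ℝ, 0 < c ∧
      ∀ S : Set (EuclideanSpace ℝ (Fin 3)), (∀ x ∈ S, ∀ z ∈ S, x ≠ z → δ ≤ dist x z) →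
        ∀ L : ℝ, 1 ≤ L → ∀ a : Fin 3 → ℝ, ∀ B : Finset (EuclideanSpace ℝ (Fin 3)),
          (↑B : Set (EuclideanSpace ℝ (Fin 3))) ⊆
            S ∩ {z : EuclideanSpace ℝ (Fin 3) | ∀ i, a i ≤ z i ∧ z i < a i + L} →
          (∀ z ∈ B, ∃ i : Fin 3, z i < a i + 6 / 5 ∨ a i + L - 6 / 5 ≤ z i) →
          (B.card : ℝ) ≤ c * L ^ 2 := by
  intro δ hδ
  have hpos : 0 < δ / 2 := by positivity
  set K : ℝ := (6 / 5 / (δ / 2) + 1) * (1 / (δ / 2) + 1) ^ 2 with hK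
  have hK0 : 0 < K := by positivity
  refine ⟨6 * K, by positivity, ?_⟩
  intro S hS L hL a B hBsub hB
  classical
  have hBS : ∀ z ∈ B, z ∈ S := fun z hz => (hBsub (Finset.mem_coe.2 hz)).1
  have hBcube : ∀ z ∈ B, ∀ i, a i ≤ z i ∧ z i < a i + L := fun z hz => (hBsub (Finset.mem_coe.2 hz)).2
  have hL0 : 0 ≤ L := by linarith
  -- slab bound: a box with two sides `L` and side `6/5` in direction `i` holds `≤ K L²` points of `S`
  have slab : ∀ (i : Fin 3) (lo : Fin 3 → ℝ) (B' : Finset (EuclideanSpace ℝ (Fin 3))),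
      (∀ z ∈ B', z ∈ S) →
      (∀ z ∈ B', ∀ j, lo j ≤ z j ∧ z j < lo j + (if j = i then 6 / 5 else L)) →
      (B'.card : ℝ) ≤ K * L ^ 2 := by
    intro i lo B' hB'S hB'box
    have hlen : ∀ j : Fin 3, (0 : ℝ) ≤ if j = i then 6 / 5 else L := by
      intro j
      split_ifs
      · norm_num
      · exact hL0
    have hle : L / (δ / 2) + 1 ≤ (1 / (δ / 2) + 1) * L := by
      have : (1 / (δ / 2) + 1) * L = L / (δ / 2) + L := by ring
      linarith
    have hsq : (L / (δ / 2) + 1) ^ 2 ≤ ((1 / (δ / 2) + 1) * L) ^ 2 :=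
      pow_le_pow_left₀ (by positivity) hle 2
    calc (B'.card : ℝ) ≤ ∏ j, ((if j = i then (6 : ℝ) / 5 else L) / (δ / 2) + 1) :=
          card_le_prod_of_separated_box hδ hS lo (fun j => if j = i then 6 / 5 else L) hlen B' hB'S hB'box
      _ = (6 / 5 / (δ / 2) + 1) * (L / (δ / 2) + 1) ^ 2 := by
          rw [prod_fin_three_eq_mul_sq (fun j => (if j = i then (6 : ℝ) / 5 else L) / (δ / 2) + 1) i
            (L / (δ / 2) + 1) fun j hj => by simp [hj]]
          simp
      _ ≤ (6 / 5 / (δ / 2) + 1) * ((1 / (δ / 2) + 1) * L) ^ 2 :=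
          mul_le_mul_of_nonneg_left hsq (by positivity)
      _ = K * L ^ 2 := by rw [hK]; ring
  -- the six slabs
  rw [mul_assoc]
  refine card_le_six_mul B (fun i z => z i < a i + 6 / 5) (fun i z => a i + L - 6 / 5 ≤ z i) hB (K * L ^ 2)
    ?_ ?_
  · intro i
    refine slab i a _ (fun z hz => hBS z (Finset.mem_filter.1 hz).1) ?_
    intro z hz j
    obtain ⟨hzB, hzi⟩ := Finset.mem_filter.1 hz
    refine ⟨(hBcube z hzB j).1, ?_⟩
    by_cases hji : j = i
    · subst hji
      rw [if_pos rfl]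
      exact hzi
    · rw [if_neg hji]
      exact (hBcube z hzB j).2
  · intro i
    refine slab i (fun j => if j = i then a i + L - 6 / 5 else a j) _
      (fun z hz => hBS z (Finset.mem_filter.1 hz).1) ?_
    intro z hz j
    obtain ⟨hzB, hzi⟩ := Finset.mem_filter.1 hz
    by_cases hji : j = i
    · subst hji
      simp only [if_true]
      exact ⟨hzi, by linarith [(hBcube z hzB j).2]⟩
    · simp only [if_neg hji]
      exact hBcube z hzB j

end Summit.AtomisticToContinuum.Crystallization.Theorems.PalmGoodLaw.FunnelBoundaryCount

end
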